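/-
Copyright (c) 2026 the pub-hodgecm-mathlib formalisation cell (harness21).  Prover seat hodgecm-mathlib-K2E4-p18 (g2), Track B «K2-LIT» ∕ h413
(stmt-HodgeConjecture-24833), deal K2E4-plan (g0) 2026-09-03T22:15:18Z: socket #22 `sig_K2E4WeakMatrixFiniteTransport` — FIRST RUNG «central-value rigidity
from germ structure» (REPORT-22 §3).  2026-09-03.
-/
import Literature.NumberTheory.Rogawski1990.FinExplicitTransferFactorConjLeft     -- ★ `finExplicitDelta_conj_left_all`  (explicit collection `Δ‴`)
import Literature.NumberTheory.Rogawski1990.FinExplicitTransferFactorConjRight    -- ★ `finExplicitDelta_conj_right_all`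
import Literature.NumberTheory.Rogawski1990.LocalTransferExistence               -- ★ `IsLocalDeltaTransferExists`, `IsLocalNondegenerate`
import Literature.NumberTheory.Rogawski1990.LocalTransferFundamentalLemma        -- ★ `IsLocSmooth`
import HarnessLib

/-!
# K2 · E4 helper — socket #22 `sig_K2E4WeakMatrixFiniteTransport` modulo GERM STRUCTURE: the central value of a weak transfer is rigid (Möbius argument)

Cell `pub/hodgecm-mathlib`, Track B «K2-LIT», seat `hodgecm-mathlib-K2E4-p18` (g2), dealer K2E4-plan (g0) (DEAL 22:15:18Z, REPORT-22 `K2/K2E4-p18/g2/REPORT-22.md`);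
crux H413 = `stmt-HodgeConjecture-24833` (supports-only helper, count-neutral).  THEOREMS ONLY (no definition, no instance, no notation, no named fact, no `sorry`).

WHY.  Socket #22 (U1 «WeakMatrixRigidity», NOT IN PRINT) transports (κ-loc)_v «`Φ^st((γ₀)_v, f) = c_v · f^H((γ_H)_v)` for every smooth transfer pair» from
Rogawski's explicit factor `Δ‴_v` to the WEAK factor `Δ v` of `hCTM` (★ `CanonicalTransferMatrix`), whose only local constraints are non-vanishing on the matching
`G`-regular pairs and EXISTENCE of smooth transfers (★ `IsLocalTransferDatum`) — no continuity, no κ-covariance.  ★ `K2E4WeakMatrixFiniteTransportOfRay` ∕ ★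
`K2E4WeakMatrixTransportOfTwist` (K2E4-p21) transport along a KNOWN ray ∕ locally-constant twist; the rigidity itself (K2E4-r01's (T)_v) was the residue.  THIS FILE
proves its load-bearing consequence, **central-value rigidity** `f^H(z) = ψ₀ · f^{H‴}(z)` (one `ψ₀ ≠ 0` for all pairs), from two in-print, typable INPUTS by pure
algebra (REPORT-22 §3; ONE matching class along a ray = every SPLIT place): (GS) a two-term GERM STRUCTURE `Φ_H(γ_n, φ) = a(φ) + b(φ)·G_n` (`n ≫ 0`) along a ray
`γ_n → z` of `G`-regular elements, `G_n` of infinite range, `φ(z) = λ·a(φ) + λ′·b(φ)` [HarishChandra ∕ Howe germs at a central element; Rogawski [R₁] `Γ₁^T =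
(−1)^{q(T)} d(St)⁻¹`, §8.1 p. 116; elliptic torus of `GL₂(F)`: regular-unipotent germ `≍ |D_H|^{-1∕2}`]; (RK2) two explicit pairs with independent `(a, b)`.  MECHANISM:
(4.3.1) for both factors and the same `f` gives `Δ‴(γ_n)·Φ_H(γ_n, f^H) = Δ(γ_n)·Φ_H(γ_n, f^{H‴})`; Cramer on the two independent pairs makes `Δ(γ_n)·D` and
`Δ(γ_n)·D·G_n` affine in `G_n` times `Δ‴(γ_n)`, whence a quadratic in `G_n` with three roots: `Δ(γ_n) = ψ₀·Δ‴(γ_n)` for `n ≫ 0`, ONE `ψ₀ ≠ 0`; then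
`a(f^H) = ψ₀ a(f^{H‴})`, `b(f^H) = ψ₀ b(f^{H‴})` for every pair.  Radially oscillating and branch twists are excluded at split places WITHOUT any continuity hypothesis
on `Δ v`.  NON-SPLIT places (two matching classes per sheet pair) need wall rigidity (REPORT-22 §4) — not treated here.

* §1 (abstract (4.3.1), any groups `A`, `B`) `stableOrbitalIntegralRel_eq_single` (one matching class ⇒ one term), the algebra `lin_coeff_eq_zero` ∕
  `quad_coeff_eq_zero` ∕ `exists_three_of_infinite_range`, **`delta_eq_const_mul_eventually_of_germStructure`** (the factor ratio is eventually constant along the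
  ray), **`centralValue_rigidity_of_germStructure`** (`∃ ψ₀ ≠ 0, f^H(z) = ψ₀ f^{H′}(z)` for all pairs), **`kappaTransport_of_germStructure`** ((κ)[T′, κ₁] ⟹
  (κ)[T, κ₁ψ₀⁻¹] for ANY functional `F` of `f`, given `T′`-transfer existence).
* §2 (finite `v`, `cmDatum` carriers) **`finKappaTransport_of_germStructure`**, **`weakMatrixFiniteTransport_of_germStructure`** — socket #22's per-place
  implication with its functional `localStableOrbitalIntegral L 3 H′ v mGs₀v f (γ₀)_v` and point `(γ_H)_v` VERBATIM (families read at the fixed `v`), modulo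
  (GS_v) + (RK2_v) + existence of smooth `Δ‴_v`-transfers + one matching class along the ray.

HONEST LABEL: HC_CM is proved only modulo the 7 printed citations (2 remaining named inputs: hLiu418 = stmt-HodgeConjecture-24832, h413 = stmt-HodgeConjecture-24833)
until rung 0 closes; this file proves no printed analytic statement and does NOT pay socket #22 (it discharges it at a place modulo (GS_v), (RK2_v), explicit
transfer existence and single matching class — REPORT-22's #22S road).

## References
* [Rogawski1990] J. D. Rogawski, *Automorphic Representations of Unitary Groups in Three Variables* (1990): §4.3 (4.3.1) p. 43; §4.9 Prop. 4.9.1 (a) p. 55;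
  §4.13 Lemma 4.13.1 (a) p. 64; §8.1 Props. 8.1.1–8.1.3, (8.1.1)–(8.1.2) pp. 114–117; §8.2 Prop. 8.2.1 (a) p. 117.
* [HarishChandra1999AdmissibleDistributions] Harish-Chandra, *Admissible invariant distributions on reductive p-adic groups*, AMS ULS 16 (1999), Thm. 3.1.
* [LanglandsShelstad1987] R. P. Langlands, D. Shelstad, On the definition of transfer factors, Math. Ann. 278 (1987), §1.3–1.4, §4.2.
-/

set_option autoImplicit false
set_option linter.dupNamespace false

noncomputable section

open MeasureTheory Measure NumberField IsDedekindDomain Filter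
open Literature.NumberTheory.Rogawski1990 Literature.NumberTheory.Automorphic Literature.NumberTheory.GaloisRepresentations
open scoped Matrix MatrixGroups

namespace Summit.HodgeConjecture.HodgeConjecture.Cruxes.H413.K2E4WeakMatrixFiniteTransportOfGermRigidity

/-! ## §1 Abstract: (4.3.1) with one matching class along a ray; the Möbius rigidity argument -/

section Abstract

variable {A B : Type*} [Group A] [Group B]
  [∀ a : A, MeasurableSpace (A ⧸ Subgroup.centralizer ({a} : Set A))]
  [∀ b : B, MeasurableSpace (B ⧸ Subgroup.centralizer ({b} : Set B))]

/-- **(4.3.1) with ONE matching class**: if `Δ_T(a, ·)` vanishes on every class but `c₀`, then `Φ^st(a, f^H) = Δ_T(a, c₀) · Φ(c₀, f)` for a `T`-pair.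
[cite: Rogawski1990, §4.3 (4.3.1) p. 43; §4.13 Lemma 4.13.1 (a) p. 64] -/
theorem stableOrbitalIntegralRel_eq_single {R : A → B → Prop} {stA : A → A → Prop} {regA : A → Prop} {T : TransferFactorData A B R}
    {mH : OrbitalMeasureFamily A} {mG : OrbitalMeasureFamily B} {fH : A → ℂ} {f : B → ℂ}
    (h : IsDeltaTransferRel R stA regA T mH mG fH f) {a : A} (ha : regA a) (c₀ : ConjClasses B)
    (hvan : ∀ c : ConjClasses B, c ≠ c₀ → T.Δ a (Quotient.out c) = 0) :
    stableOrbitalIntegralRel stA mH fH a = T.Δ a (Quotient.out c₀) * classOrbitalIntegral mG f c₀ := by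
  rw [h a ha]
  exact finsum_eq_single (fun c => T.Δ a (Quotient.out c) * classOrbitalIntegral mG f c) c₀ fun c hc => by rw [hvan c hc, zero_mul]

/-- an affine function of `x` vanishing at two distinct points is zero. [folklore] -/
theorem lin_coeff_eq_zero {r s x₁ x₂ : ℂ} (h₁ : r * x₁ + s = 0) (h₂ : r * x₂ + s = 0) (h12 : x₁ ≠ x₂) : r = 0 ∧ s = 0 := by
  have hr : r = 0 := by
    have h : r * (x₁ - x₂) = 0 := by linear_combination h₁ - h₂
    exact (mul_eq_zero.1 h).resolve_right (sub_ne_zero.2 h12)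
  refine ⟨hr, ?_⟩
  rw [hr, zero_mul, zero_add] at h₁
  exact h₁

/-- a quadratic function of `x` vanishing at three distinct points is zero. [folklore] -/
theorem quad_coeff_eq_zero {q r s x₁ x₂ x₃ : ℂ} (h₁ : q * x₁ ^ 2 + r * x₁ + s = 0) (h₂ : q * x₂ ^ 2 + r * x₂ + s = 0)
    (h₃ : q * x₃ ^ 2 + r * x₃ + s = 0) (h12 : x₁ ≠ x₂) (h13 : x₁ ≠ x₃) (h23 : x₂ ≠ x₃) : q = 0 ∧ r = 0 ∧ s = 0 := by
  have e12 : q * (x₁ + x₂) + r = 0 := by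
    have h : (x₁ - x₂) * (q * (x₁ + x₂) + r) = 0 := by linear_combination h₁ - h₂
    exact (mul_eq_zero.1 h).resolve_left (sub_ne_zero.2 h12)
  have e13 : q * (x₁ + x₃) + r = 0 := by
    have h : (x₁ - x₃) * (q * (x₁ + x₃) + r) = 0 := by linear_combination h₁ - h₃
    exact (mul_eq_zero.1 h).resolve_left (sub_ne_zero.2 h13)
  have hq : q = 0 := by
    have h : q * (x₂ - x₃) = 0 := by linear_combination e12 - e13
    exact (mul_eq_zero.1 h).resolve_right (sub_ne_zero.2 h23)
  have hr : r = 0 := by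
    rw [hq, zero_mul, zero_add] at e12
    exact e12
  refine ⟨hq, hr, ?_⟩
  rw [hq, hr, zero_mul, zero_mul, zero_add, zero_add] at h₁
  exact h₁

/-- a sequence with infinitely many values takes three distinct values beyond any index. [folklore] -/
theorem exists_three_of_infinite_range {G : ℕ → ℂ} (hG : (Set.range G).Infinite) (N : ℕ) :
    ∃ n₁ n₂ n₃ : ℕ, N ≤ n₁ ∧ N ≤ n₂ ∧ N ≤ n₃ ∧ G n₁ ≠ G n₂ ∧ G n₁ ≠ G n₃ ∧ G n₂ ≠ G n₃ := by
  have htail : (G '' {n | N ≤ n}).Infinite := by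
    have hsub : Set.range G ⊆ G '' {n | n < N} ∪ G '' {n | N ≤ n} := by
      rintro _ ⟨n, rfl⟩
      rcases lt_or_ge n N with h | h
      · exact Or.inl ⟨n, h, rfl⟩
      · exact Or.inr ⟨n, h, rfl⟩
    exact (Set.infinite_union.1 (hG.mono hsub)).resolve_left ((Set.finite_lt_nat N).image G).not_infinite
  obtain ⟨_, ⟨n₁, h₁, rfl⟩⟩ := htail.nonempty
  have h2 : ((G '' {n | N ≤ n}) \ {G n₁}).Infinite := htail.sdiff (Set.finite_singleton _)
  obtain ⟨_, ⟨⟨n₂, h₂, rfl⟩, hne₂⟩⟩ := h2.nonempty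
  have h3 : (((G '' {n | N ≤ n}) \ {G n₁}) \ {G n₂}).Infinite := h2.sdiff (Set.finite_singleton _)
  obtain ⟨_, ⟨⟨⟨n₃, h₃, rfl⟩, hne₃⟩, hne₃'⟩⟩ := h3.nonempty
  rw [Set.mem_singleton_iff] at hne₂ hne₃ hne₃'
  exact ⟨n₁, n₂, n₃, h₁, h₂, h₃, Ne.symm hne₂, Ne.symm hne₃, Ne.symm hne₃'⟩

/-- **THE FACTOR RATIO IS EVENTUALLY CONSTANT ALONG THE RAY** (Möbius argument): ray `γ_n` of regular elements with ONE matching class `c₀ n` for both factors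
(both `≠ 0` there), `G` of infinite range, germ relations `Φ^st(γ_n, ·) = a + b·G_n` for the `T`- and `T′`-transfers of two test functions, the `T′`-coefficients
linearly independent ⟹ `Δ_T(γ_n, c₀ n) = ψ₀ · Δ_{T′}(γ_n, c₀ n)` for `n ≫ 0`, one `ψ₀ ≠ 0`. [cite: Rogawski1990, §4.3 (4.3.1) p. 43; §8.1 (8.1.1)–(8.1.2) p. 117] -/
theorem delta_eq_const_mul_eventually_of_germStructure
    {R : A → B → Prop} {stA : A → A → Prop} {regA : A → Prop} {T T' : TransferFactorData A B R}
    {mH : OrbitalMeasureFamily A} {mG : OrbitalMeasureFamily B}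
    (γ : ℕ → A) (hreg : ∀ n, regA (γ n)) (c₀ : ℕ → ConjClasses B)
    (hvan : ∀ (n : ℕ) (c : ConjClasses B), c ≠ c₀ n → T.Δ (γ n) (Quotient.out c) = 0)
    (hvan' : ∀ (n : ℕ) (c : ConjClasses B), c ≠ c₀ n → T'.Δ (γ n) (Quotient.out c) = 0)
    (hT0 : ∀ n, T.Δ (γ n) (Quotient.out (c₀ n)) ≠ 0) (hT'0 : ∀ n, T'.Δ (γ n) (Quotient.out (c₀ n)) ≠ 0)
    (G : ℕ → ℂ) (hG : (Set.range G).Infinite)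
    {f₁ f₂ : B → ℂ} {fH₁ fH₂ fH'₁ fH'₂ : A → ℂ} {a₁ b₁ a₂ b₂ a'₁ b'₁ a'₂ b'₂ : ℂ}
    (h₁ : IsDeltaTransferRel R stA regA T mH mG fH₁ f₁) (h₂ : IsDeltaTransferRel R stA regA T mH mG fH₂ f₂)
    (h'₁ : IsDeltaTransferRel R stA regA T' mH mG fH'₁ f₁) (h'₂ : IsDeltaTransferRel R stA regA T' mH mG fH'₂ f₂)
    (hg₁ : ∀ᶠ n in atTop, stableOrbitalIntegralRel stA mH fH₁ (γ n) = a₁ + b₁ * G n)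
    (hg₂ : ∀ᶠ n in atTop, stableOrbitalIntegralRel stA mH fH₂ (γ n) = a₂ + b₂ * G n)
    (hg'₁ : ∀ᶠ n in atTop, stableOrbitalIntegralRel stA mH fH'₁ (γ n) = a'₁ + b'₁ * G n)
    (hg'₂ : ∀ᶠ n in atTop, stableOrbitalIntegralRel stA mH fH'₂ (γ n) = a'₂ + b'₂ * G n)
    (hD : a'₁ * b'₂ - a'₂ * b'₁ ≠ 0) :
    ∃ ψ₀ : ℂ, ψ₀ ≠ 0 ∧ ∀ᶠ n in atTop, T.Δ (γ n) (Quotient.out (c₀ n)) = ψ₀ * T'.Δ (γ n) (Quotient.out (c₀ n)) := by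
  have key : ∀ {f : B → ℂ} {fH fH' : A → ℂ}, IsDeltaTransferRel R stA regA T mH mG fH f →
      IsDeltaTransferRel R stA regA T' mH mG fH' f → ∀ n,
      T'.Δ (γ n) (Quotient.out (c₀ n)) * stableOrbitalIntegralRel stA mH fH (γ n) =
        T.Δ (γ n) (Quotient.out (c₀ n)) * stableOrbitalIntegralRel stA mH fH' (γ n) := by
    intro f fH fH' h h' n
    rw [stableOrbitalIntegralRel_eq_single h (hreg n) (c₀ n) (hvan n), stableOrbitalIntegralRel_eq_single h' (hreg n) (c₀ n) (hvan' n)]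
    ring
  obtain ⟨N, hN⟩ := eventually_atTop.1 (hg₁.and (hg₂.and (hg'₁.and hg'₂)))
  -- Cramer: `Δ·D = Δ′·(p + q G)` and `Δ·D·G = Δ′·(p′ + q′ G)` beyond `N`, with `p = a₁b′₂ − a₂b′₁`, `q = b₁b′₂ − b₂b′₁`, `p′ = a′₁a₂ − a′₂a₁`, `q′ = a′₁b₂ − a′₂b₁`
  have cramer : ∀ n, N ≤ n →
      T.Δ (γ n) (Quotient.out (c₀ n)) * (a'₁ * b'₂ - a'₂ * b'₁) =
          T'.Δ (γ n) (Quotient.out (c₀ n)) * ((a₁ * b'₂ - a₂ * b'₁) + (b₁ * b'₂ - b₂ * b'₁) * G n) ∧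
      T.Δ (γ n) (Quotient.out (c₀ n)) * (a'₁ * b'₂ - a'₂ * b'₁) * G n =
          T'.Δ (γ n) (Quotient.out (c₀ n)) * ((a'₁ * a₂ - a'₂ * a₁) + (a'₁ * b₂ - a'₂ * b₁) * G n) := by
    intro n hn
    obtain ⟨e₁, e₂, e'₁, e'₂⟩ := hN n hn
    have k₁ := key h₁ h'₁ n
    have k₂ := key h₂ h'₂ n
    rw [e₁, e'₁] at k₁
    rw [e₂, e'₂] at k₂
    constructor
    · linear_combination b'₁ * k₂ - b'₂ * k₁
    · linear_combination a'₂ * k₁ - a'₁ * k₂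
  -- hence the quadratic `q G² + (p − q′) G − p′` vanishes beyond `N`
  have quad : ∀ n, N ≤ n → (b₁ * b'₂ - b₂ * b'₁) * G n ^ 2 + ((a₁ * b'₂ - a₂ * b'₁) - (a'₁ * b₂ - a'₂ * b₁)) * G n +
      -(a'₁ * a₂ - a'₂ * a₁) = 0 := by
    intro n hn
    obtain ⟨c₁, c₂⟩ := cramer n hn
    have h : T'.Δ (γ n) (Quotient.out (c₀ n)) *
        (((a₁ * b'₂ - a₂ * b'₁) + (b₁ * b'₂ - b₂ * b'₁) * G n) * G n - ((a'₁ * a₂ - a'₂ * a₁) + (a'₁ * b₂ - a'₂ * b₁) * G n)) = 0 := by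
      linear_combination c₂ - G n * c₁
    have h' := (mul_eq_zero.1 h).resolve_left (hT'0 n)
    linear_combination h'
  obtain ⟨n₁, n₂, n₃, hn₁, hn₂, hn₃, h12, h13, h23⟩ := exists_three_of_infinite_range hG N
  obtain ⟨hq0, -, -⟩ := quad_coeff_eq_zero (quad n₁ hn₁) (quad n₂ hn₂) (quad n₃ hn₃) h12 h13 h23
  -- so `Δ·D = Δ′·p` beyond `N`, and `p ≠ 0`
  have hlin : ∀ n, N ≤ n →
      T.Δ (γ n) (Quotient.out (c₀ n)) * (a'₁ * b'₂ - a'₂ * b'₁) = T'.Δ (γ n) (Quotient.out (c₀ n)) * (a₁ * b'₂ - a₂ * b'₁) := by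
    intro n hn
    have c₁ := (cramer n hn).1
    rw [hq0, zero_mul, add_zero] at c₁
    exact c₁
  have hp0 : a₁ * b'₂ - a₂ * b'₁ ≠ 0 := by
    intro h0
    have c₁ := hlin n₁ hn₁
    rw [h0, mul_zero] at c₁
    exact (mul_ne_zero (hT0 n₁) hD) c₁
  refine ⟨(a₁ * b'₂ - a₂ * b'₁) / (a'₁ * b'₂ - a'₂ * b'₁), div_ne_zero hp0 hD, eventually_atTop.2 ⟨N, fun n hn => ?_⟩⟩
  rw [div_mul_eq_mul_div, eq_div_iff hD, mul_comm (a₁ * b'₂ - a₂ * b'₁)]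
  exact hlin n hn

/-- **CENTRAL-VALUE RIGIDITY FROM GERM STRUCTURE** (abstract form).  With the ray data of `delta_eq_const_mul_eventually_of_germStructure`, a germ structure
(GS) for the class `SmoothH` — `Φ^st(γ_n, φ) = a(φ) + b(φ)·G_n` for `n ≫ 0` and `φ(z) = λ·a(φ) + λ′·b(φ)` — transfer existence for `T` on `SmoothG`, and two
`T′`-pairs on `SmoothG × SmoothH` with linearly independent germ coefficients (RK2), there is ONE `ψ₀ ≠ 0` with `f^H(z) = ψ₀ · f^{H′}(z)` for every `f`, every
`T`-transfer `f^H ∈ SmoothH` and every `T′`-transfer `f^{H′} ∈ SmoothH`. [cite: Rogawski1990, §8.1 (8.1.1)–(8.1.2) p. 117; §8.2 Prop. 8.2.1 (a) p. 117]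
[cite: HarishChandra1999AdmissibleDistributions, Thm. 3.1] -/
theorem centralValue_rigidity_of_germStructure
    {R : A → B → Prop} {stA : A → A → Prop} {regA : A → Prop} {T T' : TransferFactorData A B R}
    {mH : OrbitalMeasureFamily A} {mG : OrbitalMeasureFamily B} (SmoothG : (B → ℂ) → Prop) (SmoothH : (A → ℂ) → Prop)
    (γ : ℕ → A) (hreg : ∀ n, regA (γ n)) (c₀ : ℕ → ConjClasses B)
    (hvan : ∀ (n : ℕ) (c : ConjClasses B), c ≠ c₀ n → T.Δ (γ n) (Quotient.out c) = 0)
    (hvan' : ∀ (n : ℕ) (c : ConjClasses B), c ≠ c₀ n → T'.Δ (γ n) (Quotient.out c) = 0)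
    (hT0 : ∀ n, T.Δ (γ n) (Quotient.out (c₀ n)) ≠ 0) (hT'0 : ∀ n, T'.Δ (γ n) (Quotient.out (c₀ n)) ≠ 0)
    (G : ℕ → ℂ) (hG : (Set.range G).Infinite) (z : A) (lam lam' : ℂ)
    (hGS : ∀ φ : A → ℂ, SmoothH φ →
      ∃ a b : ℂ, (∀ᶠ n in atTop, stableOrbitalIntegralRel stA mH φ (γ n) = a + b * G n) ∧ φ z = lam * a + lam' * b)
    (hT : ∀ f : B → ℂ, SmoothG f → ∃ fH : A → ℂ, SmoothH fH ∧ IsDeltaTransferRel R stA regA T mH mG fH f)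
    (hRK : ∃ (f₁ f₂ : B → ℂ) (fH'₁ fH'₂ : A → ℂ) (a'₁ b'₁ a'₂ b'₂ : ℂ), SmoothG f₁ ∧ SmoothG f₂ ∧ SmoothH fH'₁ ∧ SmoothH fH'₂ ∧
      IsDeltaTransferRel R stA regA T' mH mG fH'₁ f₁ ∧ IsDeltaTransferRel R stA regA T' mH mG fH'₂ f₂ ∧
      (∀ᶠ n in atTop, stableOrbitalIntegralRel stA mH fH'₁ (γ n) = a'₁ + b'₁ * G n) ∧
      (∀ᶠ n in atTop, stableOrbitalIntegralRel stA mH fH'₂ (γ n) = a'₂ + b'₂ * G n) ∧ a'₁ * b'₂ - a'₂ * b'₁ ≠ 0) :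
    ∃ ψ₀ : ℂ, ψ₀ ≠ 0 ∧ ∀ (f : B → ℂ) (fH fH' : A → ℂ), SmoothH fH → SmoothH fH' →
      IsDeltaTransferRel R stA regA T mH mG fH f → IsDeltaTransferRel R stA regA T' mH mG fH' f → fH z = ψ₀ * fH' z := by
  obtain ⟨f₁, f₂, fH'₁, fH'₂, a'₁, b'₁, a'₂, b'₂, hf₁, hf₂, -, -, h'₁, h'₂, hg'₁, hg'₂, hD⟩ := hRK
  obtain ⟨fH₁, hs₁, h₁⟩ := hT f₁ hf₁
  obtain ⟨fH₂, hs₂, h₂⟩ := hT f₂ hf₂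
  obtain ⟨a₁, b₁, hg₁, -⟩ := hGS fH₁ hs₁
  obtain ⟨a₂, b₂, hg₂, -⟩ := hGS fH₂ hs₂
  obtain ⟨ψ₀, hψ₀, hev⟩ := delta_eq_const_mul_eventually_of_germStructure γ hreg c₀ hvan hvan' hT0 hT'0 G hG h₁ h₂ h'₁ h'₂ hg₁ hg₂ hg'₁ hg'₂ hD
  refine ⟨ψ₀, hψ₀, fun f fH fH' hsH hsH' h h' => ?_⟩
  obtain ⟨a, b, hg, hz⟩ := hGS fH hsH
  obtain ⟨a', b', hg', hz'⟩ := hGS fH' hsH'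
  -- beyond some `N`: `a + b G = ψ₀ (a′ + b′ G)`
  obtain ⟨N, hN⟩ := eventually_atTop.1 (hev.and (hg.and hg'))
  have haff : ∀ n, N ≤ n → (b - ψ₀ * b') * G n + (a - ψ₀ * a') = 0 := by
    intro n hn
    obtain ⟨e, eg, eg'⟩ := hN n hn
    have k : T'.Δ (γ n) (Quotient.out (c₀ n)) * stableOrbitalIntegralRel stA mH fH (γ n) =
        T.Δ (γ n) (Quotient.out (c₀ n)) * stableOrbitalIntegralRel stA mH fH' (γ n) := by
      rw [stableOrbitalIntegralRel_eq_single h (hreg n) (c₀ n) (hvan n), stableOrbitalIntegralRel_eq_single h' (hreg n) (c₀ n) (hvan' n)]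
      ring
    rw [eg, eg', e] at k
    have k' : T'.Δ (γ n) (Quotient.out (c₀ n)) * ((a + b * G n) - ψ₀ * (a' + b' * G n)) = 0 := by linear_combination k
    have k'' := (mul_eq_zero.1 k').resolve_left (hT'0 n)
    linear_combination k''
  obtain ⟨n₁, n₂, -, hn₁, hn₂, -, h12, -, -⟩ := exists_three_of_infinite_range hG N
  obtain ⟨hb, ha⟩ := lin_coeff_eq_zero (haff n₁ hn₁) (haff n₂ hn₂) h12
  rw [hz, hz']
  linear_combination lam * ha + lam' * hb

/-- **κ-TRANSPORT FROM GERM STRUCTURE** (abstract form): with the data of `centralValue_rigidity_of_germStructure` and EXISTENCE of `T′`-transfers on `SmoothG`,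
«`F f = κ₁ · f^{H′}(z)` for every `T′`-pair» (`κ₁ ≠ 0`) implies «`F f = κ · f^H(z)` for every `T`-pair» with ONE `κ ≠ 0`, for ANY functional `F` of `f`.
[cite: Rogawski1990, §8.2 Prop. 8.2.1 (a) p. 117; §4.9 Prop. 4.9.1 (a) p. 55] -/
theorem kappaTransport_of_germStructure
    {R : A → B → Prop} {stA : A → A → Prop} {regA : A → Prop} {T T' : TransferFactorData A B R}
    {mH : OrbitalMeasureFamily A} {mG : OrbitalMeasureFamily B} (SmoothG : (B → ℂ) → Prop) (SmoothH : (A → ℂ) → Prop)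
    (γ : ℕ → A) (hreg : ∀ n, regA (γ n)) (c₀ : ℕ → ConjClasses B)
    (hvan : ∀ (n : ℕ) (c : ConjClasses B), c ≠ c₀ n → T.Δ (γ n) (Quotient.out c) = 0)
    (hvan' : ∀ (n : ℕ) (c : ConjClasses B), c ≠ c₀ n → T'.Δ (γ n) (Quotient.out c) = 0)
    (hT0 : ∀ n, T.Δ (γ n) (Quotient.out (c₀ n)) ≠ 0) (hT'0 : ∀ n, T'.Δ (γ n) (Quotient.out (c₀ n)) ≠ 0)
    (G : ℕ → ℂ) (hG : (Set.range G).Infinite) (z : A) (lam lam' : ℂ)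
    (hGS : ∀ φ : A → ℂ, SmoothH φ →
      ∃ a b : ℂ, (∀ᶠ n in atTop, stableOrbitalIntegralRel stA mH φ (γ n) = a + b * G n) ∧ φ z = lam * a + lam' * b)
    (hT : ∀ f : B → ℂ, SmoothG f → ∃ fH : A → ℂ, SmoothH fH ∧ IsDeltaTransferRel R stA regA T mH mG fH f)
    (hT' : ∀ f : B → ℂ, SmoothG f → ∃ fH' : A → ℂ, SmoothH fH' ∧ IsDeltaTransferRel R stA regA T' mH mG fH' f)
    (hRK : ∃ (f₁ f₂ : B → ℂ) (fH'₁ fH'₂ : A → ℂ) (a'₁ b'₁ a'₂ b'₂ : ℂ), SmoothG f₁ ∧ SmoothG f₂ ∧ SmoothH fH'₁ ∧ SmoothH fH'₂ ∧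
      IsDeltaTransferRel R stA regA T' mH mG fH'₁ f₁ ∧ IsDeltaTransferRel R stA regA T' mH mG fH'₂ f₂ ∧
      (∀ᶠ n in atTop, stableOrbitalIntegralRel stA mH fH'₁ (γ n) = a'₁ + b'₁ * G n) ∧
      (∀ᶠ n in atTop, stableOrbitalIntegralRel stA mH fH'₂ (γ n) = a'₂ + b'₂ * G n) ∧ a'₁ * b'₂ - a'₂ * b'₁ ≠ 0)
    (F : (B → ℂ) → ℂ) {κ₁ : ℂ} (hκ₁ : κ₁ ≠ 0)
    (h : ∀ (fH' : A → ℂ) (f : B → ℂ), SmoothG f → SmoothH fH' → IsDeltaTransferRel R stA regA T' mH mG fH' f → F f = κ₁ * fH' z) :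
    ∃ κ : ℂ, κ ≠ 0 ∧
      ∀ (fH : A → ℂ) (f : B → ℂ), SmoothG f → SmoothH fH → IsDeltaTransferRel R stA regA T mH mG fH f → F f = κ * fH z := by
  obtain ⟨ψ₀, hψ₀, hrig⟩ :=
    centralValue_rigidity_of_germStructure SmoothG SmoothH γ hreg c₀ hvan hvan' hT0 hT'0 G hG z lam lam' hGS hT hRK
  refine ⟨κ₁ * ψ₀⁻¹, mul_ne_zero hκ₁ (inv_ne_zero hψ₀), fun fH f hf hfH hrel => ?_⟩
  obtain ⟨fH', hfH', hrel'⟩ := hT' f hf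
  rw [h fH' f hf hfH' hrel', hrig f fH fH' hfH hfH' hrel hrel', mul_assoc, inv_mul_cancel_left₀ hψ₀]

end Abstract


/-! ## §2 The finite-place dress: `H_v = (U(Φ₂) × U(Φ₁))(L⁺_v)`, `G′_v = U(H′)(L⁺_v)`, test class `C_c^∞ = IsLocSmooth`; socket #22 at `v` modulo (GS_v) + (RK2_v) -/

section Fin

variable (L : Type) [Field L] [NumberField L] [IsCMField L] (H' : Matrix (Fin 3) (Fin 3) L) (v : HeightOneSpectrum (𝓞 ↥(maximalRealSubfield L)))

/-- **κ-TRANSPORT AT A FINITE PLACE FROM GERM STRUCTURE**: for two local transfer factors `T` (weak) and `T′` (reference) at `v`, both admitting smooth transfers of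
all smooth test functions (★ `IsLocalDeltaTransferExists … IsLocSmooth IsLocSmooth`), a ray `γ_n` of `G`-regular elements of `H_v` with ONE matching `G′_v`-class
`c₀ n` for both factors (non-vanishing there), a germ structure (GS_v) «`Φ^st_H(γ_n, φ) = a(φ) + b(φ)·G_n` for `n ≫ 0`, `φ(x₀) = λ a(φ) + λ′ b(φ)`» on `C_c^∞(H_v)`
with `G` of infinite range, and two `T′`-pairs with independent germ coefficients (RK2_v): «(κ)_v[T′, cv₁]» ⟹ «(κ)_v[T, cv]» with ONE `cv ≠ 0`, for ANY functional `F`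
of the `G′_v`-test function and the point `x₀`. [cite: Rogawski1990, §8.1 (8.1.1)–(8.1.2) p. 117; §8.2 Prop. 8.2.1 (a) p. 117; §4.13 Lemma 4.13.1 (a) p. 64]
[cite: HarishChandra1999AdmissibleDistributions, Thm. 3.1] -/
theorem finKappaTransport_of_germStructure
    {_ha : ∀ a : ((UnitaryGroup.cmDatum L 2 (Matrix.of fun i j : Fin 2 => if i.val + j.val + 1 = 2 then (1 : L) else 0)).Local v ×
        (UnitaryGroup.cmDatum L 1 (Matrix.of fun i j : Fin 1 => if i.val + j.val + 1 = 1 then (1 : L) else 0)).Local v),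
      MeasurableSpace (((UnitaryGroup.cmDatum L 2 (Matrix.of fun i j : Fin 2 => if i.val + j.val + 1 = 2 then (1 : L) else 0)).Local v × (UnitaryGroup.cmDatum L 1 (Matrix.of fun i j : Fin 1 => if i.val + j.val + 1 = 1 then (1 : L) else 0)).Local v) ⧸
        Subgroup.centralizer ({a} : Set ((UnitaryGroup.cmDatum L 2 (Matrix.of fun i j : Fin 2 => if i.val + j.val + 1 = 2 then (1 : L) else 0)).Local v × (UnitaryGroup.cmDatum L 1 (Matrix.of fun i j : Fin 1 => if i.val + j.val + 1 = 1 then (1 : L) else 0)).Local v)))}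
    {_hγ : ∀ γ : (UnitaryGroup.cmDatum L 3 H').Local v,
      MeasurableSpace ((UnitaryGroup.cmDatum L 3 H').Local v ⧸ Subgroup.centralizer ({γ} : Set ((UnitaryGroup.cmDatum L 3 H').Local v)))}
    {T T' : LocalTransferFactor L H' v}
    (mH : OrbitalMeasureFamily ((UnitaryGroup.cmDatum L 2 (Matrix.of fun i j : Fin 2 => if i.val + j.val + 1 = 2 then (1 : L) else 0)).Local v ×
        (UnitaryGroup.cmDatum L 1 (Matrix.of fun i j : Fin 1 => if i.val + j.val + 1 = 1 then (1 : L) else 0)).Local v))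
    (mG : OrbitalMeasureFamily ((UnitaryGroup.cmDatum L 3 H').Local v))
    (γ : ℕ → ((UnitaryGroup.cmDatum L 2 (Matrix.of fun i j : Fin 2 => if i.val + j.val + 1 = 2 then (1 : L) else 0)).Local v ×
        (UnitaryGroup.cmDatum L 1 (Matrix.of fun i j : Fin 1 => if i.val + j.val + 1 = 1 then (1 : L) else 0)).Local v)) (hreg : ∀ n, IsLocalGRegular L v (γ n))
    (c₀ : ℕ → ConjClasses ((UnitaryGroup.cmDatum L 3 H').Local v))
    (hvan : ∀ (n : ℕ) (c : ConjClasses ((UnitaryGroup.cmDatum L 3 H').Local v)), c ≠ c₀ n → T.Δ (γ n) (Quotient.out c) = 0)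
    (hvan' : ∀ (n : ℕ) (c : ConjClasses ((UnitaryGroup.cmDatum L 3 H').Local v)), c ≠ c₀ n → T'.Δ (γ n) (Quotient.out c) = 0)
    (hT0 : ∀ n, T.Δ (γ n) (Quotient.out (c₀ n)) ≠ 0) (hT'0 : ∀ n, T'.Δ (γ n) (Quotient.out (c₀ n)) ≠ 0)
    (G : ℕ → ℂ) (hG : (Set.range G).Infinite) (x₀ : ((UnitaryGroup.cmDatum L 2 (Matrix.of fun i j : Fin 2 => if i.val + j.val + 1 = 2 then (1 : L) else 0)).Local v ×
        (UnitaryGroup.cmDatum L 1 (Matrix.of fun i j : Fin 1 => if i.val + j.val + 1 = 1 then (1 : L) else 0)).Local v)) (lam lam' : ℂ)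
    (hGS : ∀ φ : ((UnitaryGroup.cmDatum L 2 (Matrix.of fun i j : Fin 2 => if i.val + j.val + 1 = 2 then (1 : L) else 0)).Local v ×
        (UnitaryGroup.cmDatum L 1 (Matrix.of fun i j : Fin 1 => if i.val + j.val + 1 = 1 then (1 : L) else 0)).Local v) → ℂ, IsLocSmooth φ →
      ∃ a b : ℂ, (∀ᶠ n in atTop, stableOrbitalIntegralRel (IsLocalStablyConjH L v) mH φ (γ n) = a + b * G n) ∧ φ x₀ = lam * a + lam' * b)
    (hT : IsLocalDeltaTransferExists L H' v T mH mG IsLocSmooth IsLocSmooth)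
    (hT' : IsLocalDeltaTransferExists L H' v T' mH mG IsLocSmooth IsLocSmooth)
    (hRK : ∃ (f₁ f₂ : (UnitaryGroup.cmDatum L 3 H').Local v → ℂ) (fH'₁ fH'₂ : ((UnitaryGroup.cmDatum L 2 (Matrix.of fun i j : Fin 2 => if i.val + j.val + 1 = 2 then (1 : L) else 0)).Local v ×
        (UnitaryGroup.cmDatum L 1 (Matrix.of fun i j : Fin 1 => if i.val + j.val + 1 = 1 then (1 : L) else 0)).Local v) → ℂ) (a'₁ b'₁ a'₂ b'₂ : ℂ),
      IsLocSmooth f₁ ∧ IsLocSmooth f₂ ∧ IsLocSmooth fH'₁ ∧ IsLocSmooth fH'₂ ∧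
      IsLocalDeltaTransfer L H' v T' mH mG fH'₁ f₁ ∧ IsLocalDeltaTransfer L H' v T' mH mG fH'₂ f₂ ∧
      (∀ᶠ n in atTop, stableOrbitalIntegralRel (IsLocalStablyConjH L v) mH fH'₁ (γ n) = a'₁ + b'₁ * G n) ∧
      (∀ᶠ n in atTop, stableOrbitalIntegralRel (IsLocalStablyConjH L v) mH fH'₂ (γ n) = a'₂ + b'₂ * G n) ∧ a'₁ * b'₂ - a'₂ * b'₁ ≠ 0)
    (F : ((UnitaryGroup.cmDatum L 3 H').Local v → ℂ) → ℂ) {cv₁ : ℂ} (h₁ : cv₁ ≠ 0)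
    (h : ∀ (fH : ((UnitaryGroup.cmDatum L 2 (Matrix.of fun i j : Fin 2 => if i.val + j.val + 1 = 2 then (1 : L) else 0)).Local v ×
        (UnitaryGroup.cmDatum L 1 (Matrix.of fun i j : Fin 1 => if i.val + j.val + 1 = 1 then (1 : L) else 0)).Local v) → ℂ)
        (f : (UnitaryGroup.cmDatum L 3 H').Local v → ℂ),
        IsLocSmooth f → IsLocSmooth fH → IsLocalDeltaTransfer L H' v T' mH mG fH f → F f = cv₁ * fH x₀) :
    ∃ cv : ℂ, cv ≠ 0 ∧
      ∀ (fH : ((UnitaryGroup.cmDatum L 2 (Matrix.of fun i j : Fin 2 => if i.val + j.val + 1 = 2 then (1 : L) else 0)).Local v ×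
        (UnitaryGroup.cmDatum L 1 (Matrix.of fun i j : Fin 1 => if i.val + j.val + 1 = 1 then (1 : L) else 0)).Local v) → ℂ)
        (f : (UnitaryGroup.cmDatum L 3 H').Local v → ℂ),
        IsLocSmooth f → IsLocSmooth fH → IsLocalDeltaTransfer L H' v T mH mG fH f → F f = cv * fH x₀ :=
  kappaTransport_of_germStructure IsLocSmooth IsLocSmooth γ hreg c₀ hvan hvan' hT0 hT'0 G hG x₀ lam lam' hGS hT hT' hRK F h₁ h

/-- **SOCKET #22 AT A PLACE, MODULO GERM STRUCTURE** — `sig_K2E4WeakMatrixFiniteTransport`'s per-place implication with its functional (`Φ^st((γ₀)_v, f)` of the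
singular family `mGs₀ v`, ★ `localStableOrbitalIntegral`) and its point `(γ_H)_v` VERBATIM (families read at the fixed `v`: `Δv := Δ v`, `mHv := mH v`,
`mGv := mG v`, `mGs₀v := mGs₀ v`), the explicit factor `Δ‴_v(μ) = finExplicitCollection L H′ μ … v` as the reference: GIVEN (i) existence of smooth
`Δ‴_v`-transfers (★ `cmSplitTransfer` at split `v`; Prop. 4.9.1 (a) in general) and of smooth `Δv`-transfers (★ `IsLocalTransferDatum` of `hCTM`), (ii) a ray
`γ_n → (γ_H)_v` in `H_v^{G-reg}` with ONE matching class for both factors (every split `v`, Lemma 4.13.1 (a)), (iii) the germ structure (GS_v) at `(γ_H)_v` and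
(iv) two explicit pairs with independent germ coefficients (RK2_v), the singular identity (κ-loc)_v transports from `Δ‴_v` to the weak `Δv` with a non-zero
constant.  The eigenvalue ∕ semiregularity binders of the socket are not read by the transport and are omitted (the statement is stronger).  REPORT-22 §3:
this is #22S modulo (GS_v) + (RK2_v); NOT the payment of #22. [cite: Rogawski1990, §8.2 Prop. 8.2.1 (a) p. 117; §4.13 Lemma 4.13.1 (a) p. 64; §8.1 (8.1.2) p. 117] -/
theorem weakMatrixFiniteTransport_of_germStructure
    {_ha : ∀ a : ((UnitaryGroup.cmDatum L 2 (Matrix.of fun i j : Fin 2 => if i.val + j.val + 1 = 2 then (1 : L) else 0)).Local v ×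
        (UnitaryGroup.cmDatum L 1 (Matrix.of fun i j : Fin 1 => if i.val + j.val + 1 = 1 then (1 : L) else 0)).Local v),
      MeasurableSpace (((UnitaryGroup.cmDatum L 2 (Matrix.of fun i j : Fin 2 => if i.val + j.val + 1 = 2 then (1 : L) else 0)).Local v × (UnitaryGroup.cmDatum L 1 (Matrix.of fun i j : Fin 1 => if i.val + j.val + 1 = 1 then (1 : L) else 0)).Local v) ⧸
        Subgroup.centralizer ({a} : Set ((UnitaryGroup.cmDatum L 2 (Matrix.of fun i j : Fin 2 => if i.val + j.val + 1 = 2 then (1 : L) else 0)).Local v × (UnitaryGroup.cmDatum L 1 (Matrix.of fun i j : Fin 1 => if i.val + j.val + 1 = 1 then (1 : L) else 0)).Local v)))}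
    {_hγ : ∀ γ : (UnitaryGroup.cmDatum L 3 H').Local v,
      MeasurableSpace ((UnitaryGroup.cmDatum L 3 H').Local v ⧸ Subgroup.centralizer ({γ} : Set ((UnitaryGroup.cmDatum L 3 H').Local v)))}
    (Δv : LocalTransferFactor L H' v) (μ : HeckeCharacter L)
    (mHv : OrbitalMeasureFamily ((UnitaryGroup.cmDatum L 2 (Matrix.of fun i j : Fin 2 => if i.val + j.val + 1 = 2 then (1 : L) else 0)).Local v ×
        (UnitaryGroup.cmDatum L 1 (Matrix.of fun i j : Fin 1 => if i.val + j.val + 1 = 1 then (1 : L) else 0)).Local v))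
    (mGv mGs₀v : OrbitalMeasureFamily ((UnitaryGroup.cmDatum L 3 H').Local v))
    (hT : IsLocalDeltaTransferExists L H' v Δv mHv mGv IsLocSmooth IsLocSmooth)
    (hTexp : IsLocalDeltaTransferExists L H' v (finExplicitCollection L H' μ (finExplicitDelta_conj_left_all L H' μ) (finExplicitDelta_conj_right_all L H' μ) v) mHv mGv IsLocSmooth IsLocSmooth)
    (γ₀ : (UnitaryGroup.cmDatum L 3 H').Rational)
    (γH : (UnitaryGroup.cmDatum L 2 (Matrix.of fun i j : Fin 2 => if i.val + j.val + 1 = 2 then (1 : L) else 0)).Rational ×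
      (UnitaryGroup.cmDatum L 1 (Matrix.of fun i j : Fin 1 => if i.val + j.val + 1 = 1 then (1 : L) else 0)).Rational)
    (γ : ℕ → ((UnitaryGroup.cmDatum L 2 (Matrix.of fun i j : Fin 2 => if i.val + j.val + 1 = 2 then (1 : L) else 0)).Local v ×
        (UnitaryGroup.cmDatum L 1 (Matrix.of fun i j : Fin 1 => if i.val + j.val + 1 = 1 then (1 : L) else 0)).Local v)) (hreg : ∀ n, IsLocalGRegular L v (γ n))
    (c₀ : ℕ → ConjClasses ((UnitaryGroup.cmDatum L 3 H').Local v))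
    (hvan : ∀ (n : ℕ) (c : ConjClasses ((UnitaryGroup.cmDatum L 3 H').Local v)), c ≠ c₀ n → Δv.Δ (γ n) (Quotient.out c) = 0)
    (hvanExp : ∀ (n : ℕ) (c : ConjClasses ((UnitaryGroup.cmDatum L 3 H').Local v)), c ≠ c₀ n →
      (finExplicitCollection L H' μ (finExplicitDelta_conj_left_all L H' μ) (finExplicitDelta_conj_right_all L H' μ) v).Δ (γ n) (Quotient.out c) = 0)
    (hΔ0 : ∀ n, Δv.Δ (γ n) (Quotient.out (c₀ n)) ≠ 0)
    (hΔexp0 : ∀ n, (finExplicitCollection L H' μ (finExplicitDelta_conj_left_all L H' μ) (finExplicitDelta_conj_right_all L H' μ) v).Δ (γ n) (Quotient.out (c₀ n)) ≠ 0)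
    (G : ℕ → ℂ) (hG : (Set.range G).Infinite) (lam lam' : ℂ)
    (hGS : ∀ φ : ((UnitaryGroup.cmDatum L 2 (Matrix.of fun i j : Fin 2 => if i.val + j.val + 1 = 2 then (1 : L) else 0)).Local v ×
        (UnitaryGroup.cmDatum L 1 (Matrix.of fun i j : Fin 1 => if i.val + j.val + 1 = 1 then (1 : L) else 0)).Local v) → ℂ, IsLocSmooth φ →
      ∃ a b : ℂ, (∀ᶠ n in atTop, stableOrbitalIntegralRel (IsLocalStablyConjH L v) mHv φ (γ n) = a + b * G n) ∧
        φ ((UnitaryGroup.cmDatum L 2 (Matrix.of fun i j : Fin 2 => if i.val + j.val + 1 = 2 then (1 : L) else 0)).toLocal v ((UnitaryGroup.cmDatum L 2 (Matrix.of fun i j : Fin 2 => if i.val + j.val + 1 = 2 then (1 : L) else 0)).toAdelic γH.1),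
            (UnitaryGroup.cmDatum L 1 (Matrix.of fun i j : Fin 1 => if i.val + j.val + 1 = 1 then (1 : L) else 0)).toLocal v ((UnitaryGroup.cmDatum L 1 (Matrix.of fun i j : Fin 1 => if i.val + j.val + 1 = 1 then (1 : L) else 0)).toAdelic γH.2)) = lam * a + lam' * b)
    (hRK : ∃ (f₁ f₂ : (UnitaryGroup.cmDatum L 3 H').Local v → ℂ) (fH'₁ fH'₂ : ((UnitaryGroup.cmDatum L 2 (Matrix.of fun i j : Fin 2 => if i.val + j.val + 1 = 2 then (1 : L) else 0)).Local v ×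
        (UnitaryGroup.cmDatum L 1 (Matrix.of fun i j : Fin 1 => if i.val + j.val + 1 = 1 then (1 : L) else 0)).Local v) → ℂ) (a'₁ b'₁ a'₂ b'₂ : ℂ),
      IsLocSmooth f₁ ∧ IsLocSmooth f₂ ∧ IsLocSmooth fH'₁ ∧ IsLocSmooth fH'₂ ∧
      IsLocalDeltaTransfer L H' v (finExplicitCollection L H' μ (finExplicitDelta_conj_left_all L H' μ) (finExplicitDelta_conj_right_all L H' μ) v) mHv mGv fH'₁ f₁ ∧
      IsLocalDeltaTransfer L H' v (finExplicitCollection L H' μ (finExplicitDelta_conj_left_all L H' μ) (finExplicitDelta_conj_right_all L H' μ) v) mHv mGv fH'₂ f₂ ∧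
      (∀ᶠ n in atTop, stableOrbitalIntegralRel (IsLocalStablyConjH L v) mHv fH'₁ (γ n) = a'₁ + b'₁ * G n) ∧
      (∀ᶠ n in atTop, stableOrbitalIntegralRel (IsLocalStablyConjH L v) mHv fH'₂ (γ n) = a'₂ + b'₂ * G n) ∧ a'₁ * b'₂ - a'₂ * b'₁ ≠ 0) :
    (∃ cv : ℂ, cv ≠ 0 ∧ ∀
          (fH : ((UnitaryGroup.cmDatum L 2 (Matrix.of fun i j : Fin 2 => if i.val + j.val + 1 = 2 then (1 : L) else 0)).Local v ×
        (UnitaryGroup.cmDatum L 1 (Matrix.of fun i j : Fin 1 => if i.val + j.val + 1 = 1 then (1 : L) else 0)).Local v) → ℂ) (f : (UnitaryGroup.cmDatum L 3 H').Local v → ℂ),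
        IsLocSmooth f → IsLocSmooth fH → IsLocalDeltaTransfer L H' v (finExplicitCollection L H' μ (finExplicitDelta_conj_left_all L H' μ) (finExplicitDelta_conj_right_all L H' μ) v) mHv mGv fH f →
        localStableOrbitalIntegral L 3 H' v mGs₀v f ((UnitaryGroup.cmDatum L 3 H').toLocal v ((UnitaryGroup.cmDatum L 3 H').toAdelic γ₀)) =
          cv * fH ((UnitaryGroup.cmDatum L 2 (Matrix.of fun i j : Fin 2 => if i.val + j.val + 1 = 2 then (1 : L) else 0)).toLocal v ((UnitaryGroup.cmDatum L 2 (Matrix.of fun i j : Fin 2 => if i.val + j.val + 1 = 2 then (1 : L) else 0)).toAdelic γH.1),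
            (UnitaryGroup.cmDatum L 1 (Matrix.of fun i j : Fin 1 => if i.val + j.val + 1 = 1 then (1 : L) else 0)).toLocal v ((UnitaryGroup.cmDatum L 1 (Matrix.of fun i j : Fin 1 => if i.val + j.val + 1 = 1 then (1 : L) else 0)).toAdelic γH.2))) →
    ∃ cv : ℂ, cv ≠ 0 ∧ ∀
          (fH : ((UnitaryGroup.cmDatum L 2 (Matrix.of fun i j : Fin 2 => if i.val + j.val + 1 = 2 then (1 : L) else 0)).Local v ×
        (UnitaryGroup.cmDatum L 1 (Matrix.of fun i j : Fin 1 => if i.val + j.val + 1 = 1 then (1 : L) else 0)).Local v) → ℂ) (f : (UnitaryGroup.cmDatum L 3 H').Local v → ℂ),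
        IsLocSmooth f → IsLocSmooth fH → IsLocalDeltaTransfer L H' v Δv mHv mGv fH f →
        localStableOrbitalIntegral L 3 H' v mGs₀v f ((UnitaryGroup.cmDatum L 3 H').toLocal v ((UnitaryGroup.cmDatum L 3 H').toAdelic γ₀)) =
          cv * fH ((UnitaryGroup.cmDatum L 2 (Matrix.of fun i j : Fin 2 => if i.val + j.val + 1 = 2 then (1 : L) else 0)).toLocal v ((UnitaryGroup.cmDatum L 2 (Matrix.of fun i j : Fin 2 => if i.val + j.val + 1 = 2 then (1 : L) else 0)).toAdelic γH.1),
            (UnitaryGroup.cmDatum L 1 (Matrix.of fun i j : Fin 1 => if i.val + j.val + 1 = 1 then (1 : L) else 0)).toLocal v ((UnitaryGroup.cmDatum L 1 (Matrix.of fun i j : Fin 1 => if i.val + j.val + 1 = 1 then (1 : L) else 0)).toAdelic γH.2)) := by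
  rintro ⟨cv₁, h₁, h⟩
  exact finKappaTransport_of_germStructure L H' v mHv mGv γ hreg c₀ hvan hvanExp hΔ0 hΔexp0 G hG _ lam lam' hGS hT hTexp hRK
    (fun f => localStableOrbitalIntegral L 3 H' v mGs₀v f ((UnitaryGroup.cmDatum L 3 H').toLocal v ((UnitaryGroup.cmDatum L 3 H').toAdelic γ₀))) h₁ h

end Fin

end Summit.HodgeConjecture.HodgeConjecture.Cruxes.H413.K2E4WeakMatrixFiniteTransportOfGermRigidity

end
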